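import Summits.CriticalPhenomena.CardyFormulaZ2.Theorems.CardyComplexConeSLESixFamiliesGiveCardyDefs
import Literature.Topology.PlaneTopology.Crosscut
import HarnessLib

/-!
# Stub `upperFence` of line `collar-touch-sandwich` — Part 1: order-topology and side lemmas

Crux `SLESixFamiliesGiveCardy` (stmt-CriticalPhenomena-9654), route `CardyComplexCone`.  First
helper file of STUB A `stub_upperFence : UpperFence` (the deterministic UPPER fence inclusion: a
free open crossing `(ab)_δ ↔ (cd)_δ` of `Ω_δ` forces the exploration interface of the collared
designer domain `D ⊇ Ω` to come within `η` of the touch set `G`).  The fence argument makes the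
open crossing, extended along two exit connectors to `∂Ω ⊆ ∂D`, into a Newman cross-cut `L′` of
the Jordan domain `D`; this file carries its non-lattice inputs, all configuration-free:

* `exists_clean_subarc`, `exists_clean_subarc_subset` — cleaning a dirty cross-cut (a path in
  `closure D` whose contacts with `∂D` lie in the two closed arcs, never in both, has a sub-path
  from an `A`-contact to a `B`-contact with no contact in between; its interior lies in `D`);
* `disjoint_of_isPreconnected_of_disjoint_frontier`, `ball_disjoint_of_disjoint_frontier` — a
  preconnected set missing `frontier U` and containing a point outside the open `U` misses `U`
  (the uniform "side" step); `inter_nonempty_of_isPreconnected_of_meets` — a preconnected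
  `T ⊆ D` meeting both Newman components meets the cross-cut;
* `exists_mem_zdArcB_of_not_mem_bcBondConfig`, `exists_mem_zdArcB_of_adj_of_not_mem_bcBondConfig`
  — the dictionary step (an `ω`-open `D_δ`-edge closed under the Dobrushin boundary condition has
  a dual-wired endpoint);
* `exists_uniform_side_ball`, `forall_int_add_notMem_Icc` — the `ω`-UNIFORM radius `τ` at a mark
  `a⁺ = D.boundary u₀ ∉ closure Ω`: `B(a⁺, τ)` misses `closure Ω` and every boundary arc
  `D.boundary '' Icc s t` with `closure Ω`-endpoints not passing through `u₀` mod `1`.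

Provenance: these lemmas were written and machine-checked by the crux's `drefute` refuters
(gens 3 and 6, files `CrosscutCleaning.lean`, `UpperFenceSideLemmasG6.lean`,
`UniformSideBallG6.lean` of the crux directory) as positive helpers for the lead; vendored here
verbatim up to names/namespaces.
-/

noncomputable section

open Set Filter Topology Metric
open Literature.Probability Literature.Probability.RandomPlanarGeometry
  Literature.Probability.LatticeModels

namespace Summit.CriticalPhenomena.CardyFormulaZ2.Cruxes.SLESixFamiliesGiveCardy.CollarTouchSandwich

/-! ### Cleaning a dirty cross-cut -/

/-- **Cleaning a dirty cross-cut.**  A path `C` on `[0, 1]` whose contacts with the closed set `F`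
all lie in `A ∪ B`, never in `A ∩ B`, starting at a contact in `A` and ending at a contact in `B`
(`F ∩ A`, `F ∩ B` closed), has a sub-path `C|[s, t]` from a contact in `A` to a contact in `B` with
NO contact strictly in between. -/
theorem exists_clean_subarc {X : Type*} [TopologicalSpace X] {C : ℝ → X}
    (hC : ContinuousOn C (Icc 0 1)) {F A B : Set X} (hFA : IsClosed (F ∩ A))
    (hFB : IsClosed (F ∩ B))
    (hcover : ∀ t ∈ Icc (0 : ℝ) 1, C t ∈ F → C t ∈ A ∨ C t ∈ B)
    (hdisj : ∀ t ∈ Icc (0 : ℝ) 1, C t ∈ A → C t ∈ B → False)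
    (h0 : C 0 ∈ F ∩ A) (h1 : C 1 ∈ F ∩ B) :
    ∃ s t : ℝ, 0 ≤ s ∧ s < t ∧ t ≤ 1 ∧ C s ∈ F ∩ A ∧ C t ∈ F ∩ B ∧
      ∀ u ∈ Ioo s t, C u ∉ F := by
  -- the set of `B`-contacts is closed and nonempty; take its minimum `t`
  set TB : Set ℝ := Icc 0 1 ∩ C ⁻¹' (F ∩ B) with hTB
  have hTBc : IsClosed TB := hC.preimage_isClosed_of_isClosed isClosed_Icc hFB
  have h1TB : (1 : ℝ) ∈ TB := ⟨⟨zero_le_one, le_rfl⟩, h1⟩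
  have hTBne : TB.Nonempty := ⟨1, h1TB⟩
  have hTBbdd : BddBelow TB := ⟨0, fun x hx => hx.1.1⟩
  set t : ℝ := sInf TB with ht
  have htmem : t ∈ TB := hTBc.csInf_mem hTBne hTBbdd
  have ht1 : t ≤ 1 := csInf_le hTBbdd h1TB
  have ht0 : 0 ≤ t := htmem.1.1
  -- the set of `A`-contacts before `t` is closed and nonempty; take its maximum `s`
  set TA : Set ℝ := Icc 0 t ∩ C ⁻¹' (F ∩ A) with hTA
  have hCt : ContinuousOn C (Icc 0 t) := hC.mono (Icc_subset_Icc le_rfl ht1)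
  have hTAc : IsClosed TA := hCt.preimage_isClosed_of_isClosed isClosed_Icc hFA
  have h0TA : (0 : ℝ) ∈ TA := ⟨⟨le_rfl, ht0⟩, h0⟩
  have hTAne : TA.Nonempty := ⟨0, h0TA⟩
  have hTAbdd : BddAbove TA := ⟨t, fun x hx => hx.1.2⟩
  set s : ℝ := sSup TA with hs
  have hsmem : s ∈ TA := hTAc.csSup_mem hTAne hTAbdd
  have hs0 : 0 ≤ s := hsmem.1.1
  have hst : s ≤ t := hsmem.1.2
  have hs1 : s ∈ Icc (0 : ℝ) 1 := ⟨hs0, hst.trans ht1⟩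
  -- `s ≠ t` because contacts are never in `A ∩ B`
  have hne : s ≠ t := by
    intro h
    have hA : C s ∈ A := hsmem.2.2
    have hB : C s ∈ B := by rw [h]; exact htmem.2.2
    exact hdisj s hs1 hA hB
  refine ⟨s, t, hs0, lt_of_le_of_ne hst hne, ht1, hsmem.2, htmem.2, ?_⟩
  intro u hu hCu
  have hu01 : u ∈ Icc (0 : ℝ) 1 := ⟨hs0.trans hu.1.le, hu.2.le.trans ht1⟩
  rcases hcover u hu01 hCu with hA | hB
  · -- an `A`-contact before `t` is at most `s`
    have huTA : u ∈ TA := ⟨⟨hs0.trans hu.1.le, hu.2.le⟩, hCu, hA⟩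
    exact absurd (le_csSup hTAbdd huTA) (not_le.2 hu.1)
  · -- a `B`-contact is at least `t`
    have huTB : u ∈ TB := ⟨hu01, hCu, hB⟩
    exact absurd (csInf_le hTBbdd huTB) (not_le.2 hu.2)

/-- Metric-space corollary in the form used for STUB A: with `F = frontier D`, `A`, `B` the two
closed boundary arcs of the designer Dobrushin domain and `C` a parametrisation of the dirty
cross-cut `[x, u] ∪ π ∪ [v, z]` inside `closure D`, the clean piece `C '' Ioo s t` avoids
`frontier D`, hence lies in `D` (as `closure D \ frontier D = interior D = D` for open `D`). -/
theorem exists_clean_subarc_subset {X : Type*} [TopologicalSpace X] {C : ℝ → X}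
    (hC : ContinuousOn C (Icc 0 1)) {D A B : Set X} (hD : IsOpen D)
    (hA : IsClosed A) (hB : IsClosed B)
    (hL : ∀ t ∈ Icc (0 : ℝ) 1, C t ∈ closure D)
    (hcover : ∀ t ∈ Icc (0 : ℝ) 1, C t ∈ frontier D → C t ∈ A ∨ C t ∈ B)
    (hdisj : ∀ t ∈ Icc (0 : ℝ) 1, C t ∈ A → C t ∈ B → False)
    (h0 : C 0 ∈ frontier D ∩ A) (h1 : C 1 ∈ frontier D ∩ B) :
    ∃ s t : ℝ, 0 ≤ s ∧ s < t ∧ t ≤ 1 ∧ C s ∈ frontier D ∩ A ∧ C t ∈ frontier D ∩ B ∧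
      C '' Ioo s t ⊆ D := by
  obtain ⟨s, t, hs0, hst, ht1, hsA, htB, hclean⟩ :=
    exists_clean_subarc hC (isClosed_frontier.inter hA) (isClosed_frontier.inter hB)
      hcover hdisj h0 h1
  refine ⟨s, t, hs0, hst, ht1, hsA, htB, ?_⟩
  rintro _ ⟨u, hu, rfl⟩
  have hu01 : u ∈ Icc (0 : ℝ) 1 := ⟨hs0.trans hu.1.le, hu.2.le.trans ht1⟩
  have hcl : C u ∈ closure D := hL u hu01
  have hnf : C u ∉ frontier D := hclean u hu
  -- `closure D = D ∪ frontier D` for an open set (in fact `interior D ∪ frontier D` in general)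
  rw [closure_eq_interior_union_frontier, hD.interior_eq] at hcl
  exact hcl.resolve_right hnf

/-! ### Side lemmas and the dictionary step -/

/-- A preconnected set missing the frontier of an open set `U` and containing a point outside `U`
is disjoint from `U`. [folklore] -/
theorem disjoint_of_isPreconnected_of_disjoint_frontier {X : Type*} [TopologicalSpace X]
    {B U : Set X} (hB : IsPreconnected B) (hU : IsOpen U) (hfr : Disjoint B (frontier U))
    {a : X} (haB : a ∈ B) (haU : a ∉ U) : Disjoint B U := by
  have hcover : B ⊆ U ∪ (closure U)ᶜ := by
    intro z hz
    by_cases hzc : z ∈ closure U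
    · left
      rw [closure_eq_interior_union_frontier, hU.interior_eq] at hzc
      rcases hzc with h | h
      · exact h
      · exact absurd h (Set.disjoint_left.1 hfr hz)
    · exact Or.inr hzc
  have hdisj : Disjoint U (closure U)ᶜ :=
    Set.disjoint_left.2 fun z hz hz' => hz' (subset_closure hz)
  rcases hB.subset_or_subset hU isClosed_closure.isOpen_compl hdisj hcover with h | h
  · exact absurd (h haB) haU
  · exact Set.disjoint_left.2 fun z hz hzU => h hz (subset_closure hzU)

/-- Metric form used in the fence argument: if the ball `B(a, τ)` misses `frontier U` (`U` open)
and its centre is not in `U`, then `B(a, τ) ∩ U = ∅`. [folklore] -/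
theorem ball_disjoint_of_disjoint_frontier {a : ℂ} {τ : ℝ} {U : Set ℂ} (hU : IsOpen U)
    (hfr : Disjoint (ball a τ) (frontier U)) (hτ : 0 < τ) (haU : a ∉ U) :
    Disjoint (ball a τ) U :=
  disjoint_of_isPreconnected_of_disjoint_frontier (convex_ball a τ).isPreconnected hU hfr
    (mem_ball_self hτ) haU

/-- **Dictionary step.** An `ω`-open edge of `Ω_δ` that is closed under the Dobrushin boundary
condition `bcBondConfig` has an endpoint on the dual-wired discrete arc. [folklore] -/
theorem exists_mem_zdArcB_of_not_mem_bcBondConfig (E : DiscreteDobrushin)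
    {ω : Percolation.BondConfig (Site 2)} {e : Sym2 (Site 2)}
    (he : e ∈ (discreteDomainGraph E.Ω E.δ).edgeSet) (hω : e ∈ ω)
    (hbc : e ∉ E.bcBondConfig ω) : ∃ x ∈ e, x ∈ E.zdArcB := by
  by_contra h
  push Not at h
  exact hbc ((E.mem_bcBondConfig_iff).2 ⟨he, Or.inr ⟨hω, h⟩⟩)

/-- The same for an edge `s(x, y)` of the open crossing graph of a SUB-domain, once the eventual
subgraph inclusion `discreteDomainGraph Ω δ ≤ discreteDomainGraph E.Ω E.δ` is available
(`MeshDomainMonotoneG6.lean`): a crossed (bc-closed) edge of the open `Ω_δ`-crossing has an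
endpoint on `zdArcB`. [folklore] -/
theorem exists_mem_zdArcB_of_adj_of_not_mem_bcBondConfig (E : DiscreteDobrushin) {Ω : Set ℂ}
    (hle : discreteDomainGraph Ω E.δ ≤ discreteDomainGraph E.Ω E.δ)
    {ω : Percolation.BondConfig (Site 2)} {x y : Site 2}
    (hxy : (Percolation.openGraph ω ⊓ discreteDomainGraph Ω E.δ).Adj x y)
    (hbc : s(x, y) ∉ E.bcBondConfig ω) : x ∈ E.zdArcB ∨ y ∈ E.zdArcB := by
  have he : s(x, y) ∈ (discreteDomainGraph E.Ω E.δ).edgeSet := by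
    rw [SimpleGraph.mem_edgeSet]; exact hle hxy.2
  have hω : s(x, y) ∈ ω := ((Percolation.openGraph_adj ω x y).1 hxy.1).1
  obtain ⟨z, hz, hzB⟩ := exists_mem_zdArcB_of_not_mem_bcBondConfig E he hω hbc
  rcases Sym2.mem_iff.1 hz with rfl | rfl
  · exact Or.inl hzB
  · exact Or.inr hzB

/-- **Crossing step.** A preconnected set `T ⊆ D` meeting both components `U₁`, `U₂` of
`D ∖ L` (open, disjoint, `U₁ ∪ U₂ = D ∖ L` — Newman's decomposition) meets the cross-cut `L`.
[folklore] -/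
theorem inter_nonempty_of_isPreconnected_of_meets {X : Type*} [TopologicalSpace X]
    {T D L U₁ U₂ : Set X} (hT : IsPreconnected T) (hTD : T ⊆ D) (hU : U₁ ∪ U₂ = D \ L)
    (h₁ : IsOpen U₁) (h₂ : IsOpen U₂) (hd : Disjoint U₁ U₂)
    (hm₁ : (T ∩ U₁).Nonempty) (hm₂ : (T ∩ U₂).Nonempty) : (T ∩ L).Nonempty := by
  by_contra h
  rw [Set.not_nonempty_iff_eq_empty] at h
  have hcover : T ⊆ U₁ ∪ U₂ := by
    rw [hU]
    intro z hz
    exact ⟨hTD hz, fun hzL => (Set.eq_empty_iff_forall_notMem.1 h) z ⟨hz, hzL⟩⟩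
  obtain ⟨z₁, hz₁T, hz₁U⟩ := hm₁
  obtain ⟨z₂, hz₂T, hz₂U⟩ := hm₂
  rcases hT.subset_or_subset h₁ h₂ hd hcover with hsub | hsub
  · exact Set.disjoint_left.1 hd (hsub hz₂T) hz₂U
  · exact Set.disjoint_left.1 hd hz₁U (hsub hz₁T)

/-! ### The uniform side ball at a mark -/

/-- **Uniform side ball.**  For a Jordan domain `D`, a closed set `C` and a boundary point
`D.boundary u₀ ∉ C` there is `τ > 0` such that the ball `B(D.boundary u₀, τ)` misses `C` and
misses every boundary arc `D.boundary '' Icc s t` with `D.boundary s, D.boundary t ∈ C` not passing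
through the parameter `u₀` modulo `1`. [folklore] -/
theorem exists_uniform_side_ball
    (D : JordanDomain) {C : Set ℂ} (hC : IsClosed C) {u₀ : ℝ} (h0 : D.boundary u₀ ∉ C) :
    ∃ τ > 0, Disjoint (ball (D.boundary u₀) τ) C ∧
      ∀ s t : ℝ, D.boundary s ∈ C → D.boundary t ∈ C → (∀ k : ℤ, u₀ + k ∉ Icc s t) →
        Disjoint (ball (D.boundary u₀) τ) (D.boundary '' Icc s t) := by
  classical
  -- a ball missing `C`
  obtain ⟨τ₁, hτ₁, hball₁⟩ : ∃ τ₁ > 0, ball (D.boundary u₀) τ₁ ⊆ Cᶜ :=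
    Metric.isOpen_iff.1 hC.isOpen_compl _ h0
  -- the closed, `1`-periodic parameter set of `C`
  set S : Set ℝ := {v | D.boundary v ∈ C} with hS
  have hSc : IsClosed S := hC.preimage D.continuous_boundary
  have hper : ∀ (v : ℝ) (k : ℤ), D.boundary (v + k) = D.boundary v := fun v k => by
    have := (D.periodic_boundary.int_mul k) v
    simpa using this
  have hSper : ∀ (v : ℝ) (k : ℤ), v + k ∈ S ↔ v ∈ S := fun v k => by
    simp only [hS, mem_setOf_eq, hper]
  have hu₀S : u₀ ∉ S := h0
  by_cases hSne : S.Nonempty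
  swap
  · refine ⟨τ₁, hτ₁, Set.disjoint_left.2 fun z hz hzC => hball₁ hz hzC, fun s t hs _ _ => ?_⟩
    exact absurd ⟨s, show s ∈ S from hs⟩ hSne
  obtain ⟨v₀, hv₀⟩ := hSne
  have hup : (S ∩ Ici u₀).Nonempty := by
    refine ⟨v₀ + (⌈u₀ - v₀⌉ : ℤ), (hSper _ _).2 hv₀, ?_⟩
    show u₀ ≤ v₀ + ((⌈u₀ - v₀⌉ : ℤ) : ℝ)
    have := Int.le_ceil (u₀ - v₀)
    linarith
  have hdown : (S ∩ Iic u₀).Nonempty := by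
    refine ⟨v₀ + (⌊u₀ - v₀⌋ : ℤ), (hSper _ _).2 hv₀, ?_⟩
    show v₀ + ((⌊u₀ - v₀⌋ : ℤ) : ℝ) ≤ u₀
    have := Int.floor_le (u₀ - v₀)
    linarith
  have hbddP : BddBelow (S ∩ Ici u₀) := ⟨u₀, fun v hv => hv.2⟩
  have hbddM : BddAbove (S ∩ Iic u₀) := ⟨u₀, fun v hv => hv.2⟩
  set uP : ℝ := sInf (S ∩ Ici u₀) with huP
  set uM : ℝ := sSup (S ∩ Iic u₀) with huM
  have huPmem : uP ∈ S ∩ Ici u₀ := (hSc.inter isClosed_Ici).csInf_mem hup hbddP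
  have huMmem : uM ∈ S ∩ Iic u₀ := (hSc.inter isClosed_Iic).csSup_mem hdown hbddM
  have huPgt : u₀ < uP :=
    lt_of_le_of_ne huPmem.2 fun h => hu₀S (by rw [h]; exact huPmem.1)
  have huMlt : uM < u₀ :=
    lt_of_le_of_ne huMmem.2 fun h => hu₀S (by rw [← h]; exact huMmem.1)
  -- the free interval `(uM, uP)` and its integer translates miss `S`
  have hfree : ∀ v, uM < v → v < uP → v ∉ S := by
    intro v hv1 hv2 hvS
    rcases le_or_gt v u₀ with h | h
    · exact not_lt.2 (le_csSup hbddM ⟨hvS, h⟩) hv1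
    · exact not_lt.2 (csInf_le hbddP ⟨hvS, h.le⟩) hv2
  have hfreeK : ∀ (v : ℝ) (k : ℤ), uM + k < v → v < uP + k → v ∉ S := by
    intro v k h1 h2 hvS
    have h' : v - k ∈ S := by
      have := hSper (v - k) k
      rw [sub_add_cancel] at this
      exact this.1 hvS
    exact hfree (v - k) (by linarith) (by linarith) h'
  -- `u₀ < uM + 1`, hence `uP ≤ uM + 1`
  have huM1S : uM + 1 ∈ S := by
    have := (hSper uM 1).2 huMmem.1
    simpa using this
  have huM1 : u₀ < uM + 1 := by
    by_contra hle
    push Not at hle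
    have := le_csSup hbddM ⟨huM1S, hle⟩
    linarith
  have huPle : uP ≤ uM + 1 := csInf_le hbddP ⟨huM1S, huM1.le⟩
  -- the compact arc `K₀ = boundary [uP, uM + 1]`, which misses the mark
  set K₀ : Set ℂ := D.boundary '' Icc uP (uM + 1) with hK₀
  have hK₀c : IsClosed K₀ := (isCompact_Icc.image D.continuous_boundary).isClosed
  have haK₀ : D.boundary u₀ ∉ K₀ := by
    rintro ⟨w, hw, hwa⟩
    have hwI : w ∈ Ico u₀ (u₀ + 1) := ⟨huPgt.le.trans hw.1, by linarith [hw.2, huMlt]⟩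
    have hu₀I : u₀ ∈ Ico u₀ (u₀ + 1) := ⟨le_rfl, by linarith⟩
    have := D.injOn_boundary_Ico u₀ hwI hu₀I hwa
    linarith [hw.1]
  obtain ⟨τ₂, hτ₂, hball₂⟩ : ∃ τ₂ > 0, ball (D.boundary u₀) τ₂ ⊆ K₀ᶜ :=
    Metric.isOpen_iff.1 hK₀c.isOpen_compl _ haK₀
  refine ⟨min τ₁ τ₂, lt_min hτ₁ hτ₂, ?_, ?_⟩
  · exact Set.disjoint_left.2 fun z hz hzC => hball₁ (ball_subset_ball (min_le_left _ _) hz) hzC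
  · intro s t hs ht hk
    -- every such arc lies in `K₀`
    have harc : D.boundary '' Icc s t ⊆ K₀ := by
      rintro _ ⟨v, hv, rfl⟩
      have hv_free : ∀ k : ℤ, ¬ (uM + k < v ∧ v < uP + k) := by
        rintro k ⟨h1, h2⟩
        have hs' : s ≤ uM + k := by
          by_contra h
          push Not at h
          exact hfreeK s k h (lt_of_le_of_lt hv.1 h2) hs
        have ht' : uP + k ≤ t := by
          by_contra h
          push Not at h
          exact hfreeK t k (lt_of_lt_of_le h1 hv.2) h ht
        exact hk k ⟨by linarith, by linarith⟩
      set k : ℤ := ⌊v - uP⌋ with hk'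
      have h1 : uP ≤ v - k := by
        have := Int.floor_le (v - uP)
        linarith
      have h2 : v - k < uP + 1 := by
        have := Int.lt_floor_add_one (v - uP)
        linarith
      have h3 : v - k ≤ uM + 1 := by
        by_contra h
        push Not at h
        refine hv_free (k + 1) ⟨?_, ?_⟩ <;> push_cast <;> linarith
      refine ⟨v - k, ⟨h1, h3⟩, ?_⟩
      have := hper (v - k) k
      rw [sub_add_cancel] at this
      exact this.symm
    exact Set.disjoint_left.2 fun z hz hzA =>
      hball₂ (ball_subset_ball (min_le_right _ _) hz) (harc hzA)

/-- Bookkeeping for the hypothesis of `exists_uniform_side_ball`: if `u₀ < s` and `t < u₀ + 1`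
then no integer translate of `u₀` lies in `[s, t]`.  (For the mark `a⁺ = D.pt 0` take
`u₀ = D.mark 0` and the cleaned cross-cut parameters `s ∈ (mark 0, mark 1)`, `t ∈ (mark 1, mark 0 + 1)`;
for `b⁺ = D.pt 1` apply it to `u₀ = D.mark 1` and the complementary arc `[t, s + 1]`.) [folklore] -/
theorem forall_int_add_notMem_Icc {u₀ s t : ℝ} (hs : u₀ < s) (ht : t < u₀ + 1) :
    ∀ k : ℤ, u₀ + k ∉ Icc s t := by
  intro k hk
  rcases le_or_gt k 0 with h | h
  · have : (k : ℝ) ≤ 0 := by exact_mod_cast h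
    linarith [hk.1]
  · have h1 : (1 : ℤ) ≤ k := by omega
    have : (1 : ℝ) ≤ k := by exact_mod_cast h1
    linarith [hk.2]

/-- Registered sub-goal of STUB A (Part 1 of `stub_upperFence`): the uniform side ball, in arrow
form (restates `exists_uniform_side_ball`). -/
theorem upperFence_part1 : ∀ (D : JordanDomain) (C : Set ℂ), IsClosed C → ∀ u₀ : ℝ, D.boundary u₀ ∉ C → ∃ τ > 0, Disjoint (ball (D.boundary u₀) τ) C ∧ ∀ s t : ℝ, D.boundary s ∈ C → D.boundary t ∈ C → (∀ k : ℤ, u₀ + k ∉ Icc s t) → Disjoint (ball (D.boundary u₀) τ) (D.boundary '' Icc s t) :=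
  fun D _ hC _ h0 ↦ exists_uniform_side_ball D hC h0

end Summit.CriticalPhenomena.CardyFormulaZ2.Cruxes.SLESixFamiliesGiveCardy.CollarTouchSandwich

end
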